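import Summits.BirchSwinnertonDyer.BirchSwinnertonDyer.Theorems.EisensteinDepletionAtTwoStarKummerEtaSqrtForm
import Summits.BirchSwinnertonDyer.BirchSwinnertonDyer.Theorems.EisensteinDepletionAtTwoStarGO2KEtaSignCharacterA
import Summits.BirchSwinnertonDyer.BirchSwinnertonDyer.Theorems.EisensteinDepletionAtTwoStarGO2KEtaExpVecParity
import Summits.BirchSwinnertonDyer.BirchSwinnertonDyer.Theorems.EisensteinDepletionAtTwoStarSymbCurrencies
import Summits.BirchSwinnertonDyer.BirchSwinnertonDyer.Theorems.EisensteinDepletionAtTwoStarKummerSqrtFormSigmaCore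
import Summits.BirchSwinnertonDyer.BirchSwinnertonDyer.Theorems.EisensteinDepletionAtTwoStarKummerSqrtFormSigma
import Literature.NumberTheory.EllipticCurves.KleinJIntegralQExpansion
import HarnessLib

/-!
# Line `kummer` v7.4, stub K-U `stub_etaSqrt` — PROVED (crux `StarGO2Sigma`, stmt-BirchSwinnertonDyer-27046; lead GEN 13)

THE SQUARE ROOT OF THE EISENSTEIN `η`-QUOTIENT (registered signature verbatim).  Assembly:
* the exponent vector `r_t = N c_t` (`exists_int_natCast_mul_stabCoeff`), `Σ r = Σ t r = 0` (admissibility);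
* K2a (tree, planner p2 GEN 38): `KEta.EtaSign.etaSignCharacter` — odd `s`, holomorphic `v`, `v² = (η-quotient)^s`, sign law on `Γ₀(N)`
  GIVEN the print fact `dedekindEta_logTransformationLaw`;
* part 1 (`…KummerEtaSqrtForm`): `V = (η-quotient)^s Δ^{2m} ∈ M_{24m}(Γ₀(N))`, `u = v·Δ^m`;
* `q`-expansions: `qExp(u)² = qExp(V) = X^{2m}·(Δ/q)^{2m}·∏ F_t^{s r_t}` (Mathlib `qExpansion_mul`, tree `qExpansion_etaQuotient_eq_map_prod_zpow`,
  `hasSum_X_mul_formalDeltaUnit`), Kr (`KEta.ExpVecParity.expVecParity`) ⟹ `∏ F_t^{s r_t} = Θ_N·W²` (p2's `etaProd_eq_theta_mul_sq`),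
  and `qExp(u) = ±X^m·√(Θ_N E²)` is RATIONAL.
Nothing here reads `r_an`; `StarGO2Sigma` / E1M / BSD are NOT proved by this file.
-/

set_option linter.dupNamespace false
set_option autoImplicit false

noncomputable section

open Complex Filter Topology Asymptotics PowerSeries
open UpperHalfPlane hiding I
open scoped Real Topology Manifold MatrixGroups ModularForm
open ModularForm CongruenceSubgroup
open Literature.NumberTheory.EllipticCurves Literature.NumberTheory.EllipticCurves.ModularForms Literature.NumberTheory.ModularForms
open Summit.BirchSwinnertonDyer.BirchSwinnertonDyer.Theorems.DepletionAtTwo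

namespace Summit.BirchSwinnertonDyer.BirchSwinnertonDyer.Theorems.DepletionAtTwo.KummerSigma.EtaSqrt

/-! ### §1 `q`-expansion bookkeeping -/

/-- Powers of a `1`-periodic function are `1`-periodic. [folklore] -/
theorem periodic_pow {f : ℍ → ℂ} (h : Function.Periodic (f ∘ ofComplex) 1) (j : ℕ) :
    Function.Periodic ((f ^ j) ∘ ofComplex) 1 := fun x ↦ by
  have hx := h x
  simp only [Function.comp_apply, Pi.pow_apply] at hx ⊢
  rw [hx]

/-- Powers of a function bounded at `i∞` are bounded at `i∞`. [folklore] -/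
theorem isBoundedAtImInfty_pow {f : ℍ → ℂ} (h : IsBoundedAtImInfty f) : ∀ j : ℕ, IsBoundedAtImInfty (f ^ j)
  | 0 => by rw [pow_zero]; exact Filter.const_boundedAtFilter atImInfty (1 : ℂ)
  | j + 1 => by rw [pow_succ]; exact (isBoundedAtImInfty_pow h j).mul h

/-- Powers: for `f` periodic, holomorphic and bounded, `qExp(f^k) = qExp(f)^k`. [folklore] -/
theorem qExpansion_pow_of {f : ℍ → ℂ} (hper : Function.Periodic (f ∘ ofComplex) 1) (hmd : MDiff f)
    (hbdd : IsBoundedAtImInfty f) (k : ℕ) : qExpansion 1 (f ^ k) = qExpansion 1 f ^ k := by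
  have han : ∀ j : ℕ, AnalyticAt ℂ (cuspFunction 1 (f ^ j)) 0 := fun j ↦
    UpperHalfPlane.analyticAt_cuspFunction_zero one_pos (periodic_pow hper j) (hmd.pow j)
      (isBoundedAtImInfty_pow hbdd j)
  induction k with
  | zero => rw [pow_zero, pow_zero, qExpansion_one]
  | succ k ih =>
    have h1 := han 1
    rw [pow_one] at h1
    rw [pow_succ, pow_succ, UpperHalfPlane.qExpansion_mul (han k) h1, ih]

/-- The `q`-expansion of `Δ` is `q·∏(1−qⁿ)²⁴ = X·formalDeltaUnit`. [cite: Cox2013, §11.A Thm. 11.8] -/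
theorem qExpansion_discriminant :
    qExpansion 1 (ModularForm.discriminant : ℍ → ℂ) = (X * formalDeltaUnit).map (Int.castRingHom ℂ) := by
  have hT : (ModularForm.discriminant : ℍ → ℂ) ∣[(12 : ℤ)] ModularGroup.T = ModularForm.discriminant :=
    ModularForm.discriminant_T_invariant
  have hper := periodic_of_slash_T hT
  have hbdd : IsBoundedAtImInfty (ModularForm.discriminant : ℍ → ℂ) := by
    simpa using ModularFormClass.bdd_at_infty_slash CuspForm.discriminant (1 : SL(2, ℤ))
  ext n
  rw [coeff_map, Int.coe_castRingHom]
  exact qExpansion_one_coeff_eq_of_hasSum hper CuspForm.discriminant.holo' hbdd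
    (fun τ ↦ by simpa using hasSum_X_mul_formalDeltaUnit τ) n

/-! ### §2 Kr ⟹ `∏ F_t^{r_t} = Θ_N · u²` (planner p2 GEN 38, KummerV7Sketch §4) -/

/-- A unit of `ℤ⟦q⟧` with constant coefficient `1` has all its integer powers with constant coefficient `1`. [folklore] -/
theorem constantCoeff_units_zpow {u : (PowerSeries ℤ)ˣ} (hu : constantCoeff (u : PowerSeries ℤ) = 1) (z : ℤ) :
    constantCoeff ((u ^ z : (PowerSeries ℤ)ˣ) : PowerSeries ℤ) = 1 := by
  have hinv : constantCoeff ((u⁻¹ : (PowerSeries ℤ)ˣ) : PowerSeries ℤ) = 1 := by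
    have h := congrArg constantCoeff u.mul_inv
    rwa [map_mul, map_one, hu, one_mul] at h
  obtain ⟨k, rfl | rfl⟩ := z.eq_nat_or_neg
  · rw [zpow_natCast, Units.val_pow_eq_pow_val, map_pow, hu, one_pow]
  · rw [zpow_neg, zpow_natCast, ← inv_pow, Units.val_pow_eq_pow_val, map_pow, hinv, one_pow]

/-- Kr ⟹ `∏_{t∣N} F_t^{r_t} = Θ_N · u²` with `u` a unit of `ℤ⟦q⟧` of constant coefficient `1`. [folklore] -/
theorem etaProd_eq_theta_mul_sq {N : ℕ} {r : ℕ → ℤ} (hr : ∀ t ∈ N.divisors, Odd (r t) ↔ t ∈ kummerThetaDivisors N) :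
    ∃ u : (PowerSeries ℤ)ˣ, constantCoeff (u : PowerSeries ℤ) = 1 ∧
      ((∏ t ∈ N.divisors, (isUnit_formalEulerScaled t).unit ^ r t : (PowerSeries ℤ)ˣ) : PowerSeries ℤ) =
        kummerThetaSeries N * (u : PowerSeries ℤ) ^ 2 := by
  classical
  set U : ℕ → (PowerSeries ℤ)ˣ := fun t => (isUnit_formalEulerScaled t).unit with hU
  have hU1 : ∀ t, constantCoeff ((U t : (PowerSeries ℤ)ˣ) : PowerSeries ℤ) = 1 := fun t => by
    rw [hU, IsUnit.unit_spec, constantCoeff_formalEulerScaled]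
  have hdec : ∀ t ∈ N.divisors, ∃ e : ℤ, r t = (if t ∈ kummerThetaDivisors N then 1 else 0) + 2 * e := by
    intro t ht
    by_cases hT : t ∈ kummerThetaDivisors N
    · obtain ⟨e, he⟩ := (hr t ht).mpr hT
      exact ⟨e, by rw [if_pos hT, he]; ring⟩
    · rcases Int.even_or_odd (r t) with h | h
      · obtain ⟨e, he⟩ := h
        exact ⟨e, by rw [if_neg hT, he]; ring⟩
      · exact absurd ((hr t ht).mp h) hT
  choose! e he using hdec
  refine ⟨∏ t ∈ N.divisors, U t ^ e t, ?_, ?_⟩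
  · rw [Units.coe_prod, map_prod]
    exact Finset.prod_eq_one fun t _ => constantCoeff_units_zpow (hU1 t) (e t)
  · have hprod : (∏ t ∈ N.divisors, U t ^ r t) =
        (∏ t ∈ N.divisors, if t ∈ kummerThetaDivisors N then U t else 1) * (∏ t ∈ N.divisors, U t ^ e t) ^ 2 := by
      rw [← Finset.prod_pow, ← Finset.prod_mul_distrib]
      refine Finset.prod_congr rfl fun t ht => ?_
      rw [he t ht, zpow_add, show (2 : ℤ) * e t = e t * 2 by ring, zpow_mul]
      by_cases hT : t ∈ kummerThetaDivisors N
      · rw [if_pos hT, if_pos hT, zpow_one]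
        norm_cast
      · rw [if_neg hT, if_neg hT, zpow_zero]
        norm_cast
    have hT : (∏ t ∈ N.divisors, if t ∈ kummerThetaDivisors N then U t else 1) = ∏ t ∈ kummerThetaDivisors N, U t := by
      rw [Finset.prod_ite_mem, Finset.inter_eq_right.mpr (kummerThetaDivisors_subset N)]
    rw [hprod, hT, Units.val_mul, Units.val_pow_eq_pow_val, Units.coe_prod, kummerThetaSeries]
    exact congrArg (· * _) (Finset.prod_congr rfl fun t _ => by rw [hU, IsUnit.unit_spec])

/-! ### §3 The stub -/

/-- **Stub K-U `stub_etaSqrt` of line `kummer` v7.4 (crux `StarGO2Sigma`, stmt-BirchSwinnertonDyer-27046), registered signature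
verbatim — PROVED.**  See the file docstring. [cite: RademacherGrosswald1972, Ch. 4 A, eq. (60)] [cite: Stevens1982, §2.4–2.5] -/
theorem stub_etaSqrt :
    ∀ (N : ℕ) [NeZero N] (β : ℕ → ℕ), Odd N → IsAdmissibleStabData N β → ∀ (g' : ℚ),
      (∀ x : ℚ, (∃ γ : Gamma0 N,
        stabEisensteinPeriod N β ((γ : SL(2, ℤ)) 0 0) ((γ : SL(2, ℤ)) 0 1) ((γ : SL(2, ℤ)) 1 0) ((γ : SL(2, ℤ)) 1 1) = x) ↔
          ∃ n : ℤ, x = n * g') →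
      Literature.NumberTheory.ModularForms.dedekindEta_logTransformationLaw →
      ∃ (m : ℕ) (V : ModularForm (Gamma0 N) ((24 * m : ℕ) : ℤ)) (u : UpperHalfPlane → ℂ)
        (U : PowerSeries ℚ) (E : PowerSeries ℤ),
        MDifferentiable 𝓘(ℂ) 𝓘(ℂ) u ∧ (∀ τ : UpperHalfPlane, u τ ≠ 0) ∧ (∀ τ : UpperHalfPlane, u τ ^ 2 = V τ) ∧
        (∀ γ : SL(2, ℤ), γ ∈ Gamma0 N → ∀ n : ℤ,
          stabEisensteinPeriod N β (γ 0 0) (γ 0 1) (γ 1 0) (γ 1 1) = n * g' →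
            u ∣[((12 * m : ℕ) : ℤ)] γ = ((-1 : ℂ) ^ n.natAbs) • u) ∧
        (∀ n : ℕ, PowerSeries.coeff n (UpperHalfPlane.qExpansion (1 : ℝ) u) = ((PowerSeries.coeff n U : ℚ) : ℂ)) ∧
        PowerSeries.constantCoeff E = 1 ∧
        U ^ 2 = PowerSeries.map (Int.castRingHom ℚ)
          (PowerSeries.X ^ (2 * m) * kummerThetaSeries N * E ^ 2) := by
  intro N _ β hodd hadm g' hgen H
  have hN : N ≠ 0 := NeZero.ne N
  -- the exponent vector `r_t = N c_t`
  choose z hz using fun t ↦ exists_int_natCast_mul_stabCoeff (β := β) hN t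
  have hr : ∀ t ∈ N.divisors, (z t : ℚ) = N * stabCoeff N β t := fun t _ ↦ (hz t).symm
  have hsum0 : ∑ t ∈ N.divisors, z t = 0 := by
    have h : (∑ t ∈ N.divisors, (z t : ℚ)) = 0 := by
      rw [Finset.sum_congr rfl fun t _ ↦ (hz t).symm, ← Finset.mul_sum, sum_divisors_stabCoeff_eq_zero hN hadm, mul_zero]
    exact_mod_cast h
  have hsum1 : ∑ t ∈ N.divisors, (t : ℤ) * z t = 0 := by
    have h : (∑ t ∈ N.divisors, (t : ℚ) * (z t : ℚ)) = 0 := by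
      rw [Finset.sum_congr rfl fun (t : ℕ) _ ↦ show (t : ℚ) * (z t : ℚ) = N * (stabCoeff N β t * t) by rw [← hz t]; ring,
        ← Finset.mul_sum, sum_divisors_stabCoeff_mul_self_eq_zero hN hadm, mul_zero]
    exact_mod_cast h
  -- K2a
  obtain ⟨s, v, hs, hvd, hvsq, hvsign⟩ := KEta.EtaSign.etaSignCharacter H N β z hodd hadm hr g' hgen
  -- every `γ ∈ Γ₀(N)` has an Eisenstein integer
  have hper : ∀ γ : SL(2, ℤ), γ ∈ Gamma0 N → ∃ n : ℤ,
      stabEisensteinPeriod N β (γ 0 0) (γ 0 1) (γ 1 0) (γ 1 1) = n * g' :=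
    fun γ hγ ↦ (hgen _).mp ⟨⟨γ, hγ⟩, rfl⟩
  have hvinv : ∀ γ : SL(2, ℤ), γ ∈ Gamma0 N → ∀ τ : ℍ, v (γ • τ) ^ 2 = v τ ^ 2 := by
    intro γ hγ τ
    obtain ⟨n, hn⟩ := hper γ hγ
    have h1 : ((-1 : ℂ) ^ n) ^ 2 = 1 := by
      rw [← zpow_natCast, ← zpow_mul, mul_comm, zpow_mul]; norm_num
    rw [hvsign γ hγ n hn τ, mul_pow, h1]; ring
  -- the modular form `V` and the square root `u = v·Δ^m`
  set B : ℤ := (s : ℤ) * ∑ t ∈ N.divisors, |z t| * (t : ℤ) ^ 2 * N with hB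
  set m : ℕ := B.toNat with hmdef
  have hm : (s : ℤ) * ∑ t ∈ N.divisors, |z t| * (t : ℤ) ^ 2 * N ≤ m := by
    rw [hmdef]; exact Int.self_le_toNat B
  set V := etaPowModularForm N z s m v hsum0 hvsq hvinv hm with hVdef
  obtain ⟨hud, hune, husq, humul⟩ := etaSqrtFn_props N z s m v hvd hvsq
  set u : ℍ → ℂ := fun τ ↦ v τ * ModularForm.discriminant τ ^ m with hudef
  have husqV : ∀ τ : ℍ, u τ ^ 2 = V τ := fun τ ↦ by
    rw [hudef, husq τ, hVdef, coe_etaPowModularForm]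
  have humul' : ∀ γ : SL(2, ℤ), γ ∈ Gamma0 N → ∀ n : ℤ,
      stabEisensteinPeriod N β (γ 0 0) (γ 0 1) (γ 1 0) (γ 1 1) = n * g' →
        u ∣[((12 * m : ℕ) : ℤ)] γ = ((-1 : ℂ) ^ n.natAbs) • u :=
    fun γ hγ n hn ↦ humul γ n (hvsign γ hγ n hn)
  -- `u` is `1`-periodic and bounded, so its cusp function is analytic
  have hT0 : stabEisensteinPeriod N β ((ModularGroup.T : SL(2, ℤ)) 0 0) ((ModularGroup.T : SL(2, ℤ)) 0 1)
      ((ModularGroup.T : SL(2, ℤ)) 1 0) ((ModularGroup.T : SL(2, ℤ)) 1 1) = (0 : ℤ) * g' := by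
    rw [show ((ModularGroup.T : SL(2, ℤ)) 1 0) = 0 by simp [ModularGroup.T], KEta.EtaSign.period_of_c_eq_zero hN hadm]
    simp
  have huT : u ∣[((12 * m : ℕ) : ℤ)] ModularGroup.T = u := by
    rw [humul' _ (modularT_mem_Gamma0 N) 0 hT0]; simp
  have hu_per := periodic_of_slash_T huT
  have hu_bdd : IsBoundedAtImInfty u :=
    isBoundedAtImInfty_of_norm_sq (fun τ ↦ by rw [← norm_pow, husqV]) (isBoundedAtImInfty_modularForm_gamma0 V)
  have hu_an : AnalyticAt ℂ (cuspFunction 1 u) 0 := UpperHalfPlane.analyticAt_cuspFunction_zero one_pos hu_per hud hu_bdd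
  -- `qExp(u)² = qExp(η-quotient)^s · qExp(Δ)^{2m}`
  have hη : IsIntUnitQExp (etaQuotient N z) := isIntUnitQExp_etaQuotient N z hsum1
  have hΔT : (ModularForm.discriminant : ℍ → ℂ) ∣[(12 : ℤ)] ModularGroup.T = ModularForm.discriminant :=
    ModularForm.discriminant_T_invariant
  have hΔper := periodic_of_slash_T hΔT
  have hΔbdd : IsBoundedAtImInfty (ModularForm.discriminant : ℍ → ℂ) := by
    simpa using ModularFormClass.bdd_at_infty_slash CuspForm.discriminant (1 : SL(2, ℤ))
  have hΔmd : MDiff (ModularForm.discriminant : ℍ → ℂ) := CuspForm.discriminant.holo'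
  have hsq : qExpansion 1 u ^ 2 =
      ((((∏ t ∈ N.divisors, (isUnit_formalEulerScaled t).unit ^ z t : (PowerSeries ℤ)ˣ) : PowerSeries ℤ) ^ s *
        (X * formalDeltaUnit) ^ (2 * m)).map (Int.castRingHom ℂ)) := by
    have hfun : u * u = (etaQuotient N z) ^ s * (ModularForm.discriminant) ^ (2 * m) := by
      funext τ
      simp only [Pi.mul_apply, Pi.pow_apply]
      rw [← sq, husqV, hVdef, coe_etaPowModularForm, etaQuotient_shiftExp hN]
    rw [sq, ← UpperHalfPlane.qExpansion_mul hu_an hu_an, hfun,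
      UpperHalfPlane.qExpansion_mul
        (UpperHalfPlane.analyticAt_cuspFunction_zero one_pos (periodic_pow hη.periodic s) (hη.mdiff.pow s)
          (isBoundedAtImInfty_pow hη.bdd s))
        (UpperHalfPlane.analyticAt_cuspFunction_zero one_pos (periodic_pow hΔper _) (hΔmd.pow _)
          (isBoundedAtImInfty_pow hΔbdd (2 * m))),
      qExpansion_pow_of hη.periodic hη.mdiff hη.bdd, qExpansion_pow_of hΔper hΔmd hΔbdd,
      qExpansion_etaQuotient_eq_map_prod_zpow N z hsum1, qExpansion_discriminant]
    simp only [map_mul, map_pow]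
  -- Kr: `(∏ F_t^{r_t})^s = Θ_N · W²`
  have hrs : ∀ t ∈ N.divisors, Odd ((s : ℤ) * z t) ↔ t ∈ kummerThetaDivisors N := by
    intro t ht
    rw [Int.odd_mul, ← KEta.ExpVecParity.expVecParity N β z hodd hadm hr t ht]
    exact ⟨fun h ↦ h.2, fun h ↦ ⟨by exact_mod_cast hs, h⟩⟩
  obtain ⟨W, hW1, hW⟩ := etaProd_eq_theta_mul_sq hrs
  have hpow : ((∏ t ∈ N.divisors, (isUnit_formalEulerScaled t).unit ^ z t : (PowerSeries ℤ)ˣ) : PowerSeries ℤ) ^ s =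
      kummerThetaSeries N * (W : PowerSeries ℤ) ^ 2 := by
    rw [← hW, ← Units.val_pow_eq_pow_val, ← Finset.prod_pow]
    congr 1
    exact Finset.prod_congr rfl fun t _ ↦ by rw [← zpow_natCast, ← zpow_mul, mul_comm]
  -- the integer series `E` and the rational square root `U`
  set E : PowerSeries ℤ := formalDeltaUnit ^ m * (W : PowerSeries ℤ) with hEdef
  have hE1 : constantCoeff E = 1 := by
    rw [hEdef, map_mul, map_pow, hW1, mul_one]
    have : constantCoeff formalDeltaUnit = 1 := by
      rw [← coeff_zero_eq_constantCoeff_apply, formalDeltaUnit, coeff_mk, deltaFactorProd, Finset.range_zero,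
        Finset.prod_empty, coeff_zero_eq_constantCoeff_apply, map_one]
    rw [this, one_pow]
  have hsq' : qExpansion 1 u ^ 2 = (X ^ (2 * m) * kummerThetaSeries N * E ^ 2).map (Int.castRingHom ℂ) := by
    rw [hsq, hpow, hEdef]
    congr 1
    ring
  have hΘE1 : constantCoeff ((kummerThetaSeries N * E ^ 2).map (Int.castRingHom ℚ)) = 1 := by
    rw [KummerAlg.constantCoeff_map', map_mul, map_pow, constantCoeff_kummerThetaSeries, hE1, one_pow, mul_one, map_one]
  obtain ⟨Bq, hBq1, hBq⟩ := KummerSigma.exists_sqrt_of_constantCoeff_eq_one _ hΘE1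
  -- `qExp(u) = ± X^m · Bq`
  have hsq2 : qExpansion 1 u * qExpansion 1 u =
      (X ^ m * Bq.map (algebraMap ℚ ℂ)) * (X ^ m * Bq.map (algebraMap ℚ ℂ)) := by
    rw [← sq, hsq', ← KummerAlg.map_rat_map_int, mul_assoc, map_mul (PowerSeries.map (Int.castRingHom ℚ)), ← hBq]
    simp only [map_mul, map_pow, map_X]
    ring
  obtain ⟨ε, hε1, hε⟩ : ∃ ε : ℚ, (ε = 1 ∨ ε = -1) ∧ qExpansion 1 u = (C (ε : ℂ)) * (X ^ m * Bq.map (algebraMap ℚ ℂ)) := by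
    rcases mul_self_eq_mul_self_iff.mp hsq2 with h | h
    · exact ⟨1, Or.inl rfl, by rw [h, Rat.cast_one, map_one, one_mul]⟩
    · exact ⟨-1, Or.inr rfl, by rw [h, Rat.cast_neg, Rat.cast_one, map_neg, map_one, neg_one_mul]⟩
  refine ⟨m, V, u, C ε * (X ^ m * Bq), E, hud, hune, husqV, humul', fun n ↦ ?_, hE1, ?_⟩
  · rw [hε, ← eq_ratCast (algebraMap ℚ ℂ), ← map_C (algebraMap ℚ ℂ), ← map_X (algebraMap ℚ ℂ) , ← map_pow, ← map_mul,
      ← map_mul, coeff_map, eq_ratCast]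
  · have hε2 : (C ε : PowerSeries ℚ) ^ 2 = 1 := by
      rcases hε1 with h | h <;> simp [h]
    rw [show (C ε * (X ^ m * Bq)) ^ 2 = (C ε) ^ 2 * X ^ (2 * m) * Bq ^ 2 by ring, hε2, one_mul, hBq]
    simp only [map_mul, map_pow, map_X, mul_assoc]

end Summit.BirchSwinnertonDyer.BirchSwinnertonDyer.Theorems.DepletionAtTwo.KummerSigma.EtaSqrt

end
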